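import Mathlib
import Summits.Ventures.PercRepro2.LocRows
import Summits.Ventures.PercRepro2.SwRow
import Summits.Ventures.PercRepro2.SwOut
import Summits.Ventures.PercRepro2.SwAllRow
import Summits.Ventures.PercRepro2.SwOutAll
import Summits.Ventures.PercRepro2.SwOutArmFlip
import Summits.Ventures.PercRepro2.SwOutArms
import Summits.Ventures.PercRepro2.SwOutArmOrbit
import Summits.Ventures.PercRepro2.SwOutArmCube
import Summits.Ventures.PercRepro2.SwOutArmThm
import Summits.Ventures.PercRepro2.SwOutCoreShadowUnion

/-!
# Arm-closed sets are unions of coarse arms, and their flips are orbit points (blind cell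
PercRepro2, night-4 g19, 2026-08-27; proofs/NIGHT4-G19.md §5 (ii))

Two general facts on the coarse orbits of the arm principle: an arm-closed set (inside
`hull ∖ {h}`, closed under adjacency there) is the union of the coarse arms it contains
(`armClosed_eq_armsUnion` — a coarse arm meeting it is the arm of one of its vertices, hence inside
it), and the flip of a union of coarse arms of a core-free configuration lies in its coarse orbit
(`flip_armsUnion_mem_orbit`: the blue side is a union of coarse arms, flips of unions of arms
compose, `flip_armsUnion_flip_armsUnion`).  The converse of `exists_armsUnion_of_mem_orbit`.
-/

namespace Summit.Ventures.PercRepro2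

namespace BigBlock

open Hull LocRows

variable {V : Type*} {E : Type*} [Fintype E] [DecidableEq E]

open scoped Classical

section Orbits

variable {ends : E → Sym2 V} {ζ : Config E} {h : V}

omit [DecidableEq E] in
/-- An arm-closed set is the union of the coarse arms it contains. -/
lemma armClosed_eq_armsUnion {S : Set V} (hS : ArmClosed ends ζ h S) :
    S = armsUnion (arms ends ζ h) fun Q => Q ⊆ S := by
  ext x
  constructor
  · intro hx
    obtain ⟨Q, hQ, hxQ⟩ := exists_mem_arms (hS.subset x hx).1 (hS.subset x hx).2
    refine ⟨Q, hQ, ?_, hxQ⟩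
    -- `Q` is the arm of one of its vertices, connected to `x` inside `hull ∖ {h}`
    simp only [arms, Finset.mem_image] at hQ
    obtain ⟨e, he, rfl⟩ := hQ
    obtain ⟨y, _, _, _, hPy⟩ := armOfEdge_eq_arm he
    rw [hPy] at hxQ ⊢
    have hclosed : ∀ a ∈ S, ∀ b, (openGraph ends (armConfig ends ζ h)).Adj a b → b ∈ S := by
      intro a ha b hab
      obtain ⟨_, e', he', hends⟩ := openGraph_adj.1 hab
      obtain ⟨a', ha', b', hb', hab'⟩ := armConfig_eq_true_iff.1 he'
      have hbH : b ∈ hull ends ζ h \ {h} := by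
        rw [hends, Sym2.eq_iff] at hab'
        rcases hab' with ⟨_, h2⟩ | ⟨_, h2⟩
        · rw [h2]; exact hb'
        · rw [h2]; exact ha'
      exact hS.closed e' a b hends ha hbH.1 (fun h' => hbH.2 (Set.mem_singleton_iff.2 h'))
    have hyS : y ∈ S := mem_of_conn_of_closed hclosed hx (conn_symm hxQ)
    intro z hz
    exact mem_of_conn_of_closed hclosed hyS hz
  · rintro ⟨Q, _, hQS, hx⟩
    exact hQS hx

omit [DecidableEq E] in
/-- **The flip of a union of coarse arms of a core-free configuration lies in its coarse
orbit.** -/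
theorem flip_armsUnion_mem_orbit (hc : CoreFree ends ζ h) (P : Set V → Prop) :
    flip ends (armsUnion (arms ends ζ h) P) ζ ∈ orbit ends (allRed ends ζ h) h := by
  have hBarms : cluster ends (blue ζ) h \ {h} =
      armsUnion (arms ends ζ h) fun Q => Q ⊆ cluster ends (blue ζ) h \ {h} :=
    armClosed_eq_armsUnion (armClosed_blueSide hc)
  have harms : arms ends (allRed ends ζ h) h = arms ends ζ h :=
    arms_eq_of_hull_eq (hull_allRed hc)
  have key := flip_armsUnion_flip_armsUnion (ends := ends) (h := h) ζ P
    (fun Q => Q ⊆ cluster ends (blue ζ) h \ {h}) (allRed ends ζ h)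
  rw [← hBarms] at key
  have hζ : flip ends (cluster ends (blue ζ) h \ {h}) (allRed ends ζ h) = ζ := by
    unfold allRed
    exact Hull.flip_flip _ _
  rw [hζ] at key
  rw [key]
  simp only [orbit, Finset.mem_image, Finset.mem_univ, true_and]
  refine ⟨fun Q : arms ends (allRed ends ζ h) h =>
    decide (¬ Xor (P Q.1) (Q.1 ⊆ cluster ends (blue ζ) h \ {h})), ?_⟩
  unfold orbitReal
  rw [armsFalse_eq_armsUnion, allRed_idem hc]
  congr 1
  ext x
  simp only [mem_armsUnion_iff, decide_eq_false_iff_not, not_not]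
  constructor
  · rintro ⟨Q, hQ, ⟨_, hx⟩, hxQ⟩
    exact ⟨Q, by rw [← harms]; exact hQ, hx, hxQ⟩
  · rintro ⟨Q, hQ, hx, hxQ⟩
    exact ⟨Q, by rw [harms]; exact hQ, ⟨by rw [harms]; exact hQ, hx⟩, hxQ⟩

end Orbits

end BigBlock

end Summit.Ventures.PercRepro2
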